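import Mathlib.Data.Fin.Tuple.Sort
import Mathlib.LinearAlgebra.Dimension.Constructions
import Literature.Computability.AlgebraicComplexity.SingleProductExchange
import HarnessLib

/-!
# Substitution with backtracking: soundness of the case analysis (Wang 2026, §6–§7)

Topic `Literature/Computability/AlgebraicComplexity`. Everything here is PROVED for an arbitrary
bilinear map `φ : U × V → W` over a field; no named facts.

Wang 2026 bounds the rank of a tensor with its first factor constrained to a subspace
`S = constrSub K` (the common zero set of a list `K` of linear forms, §3.2) by four techniques; the
fourth, *substitution with backtracking* (§6, Lemma 3 and the DFS "over canonical
`A`-components … one per canonical nonzero form at each level"), is a case analysis over the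
first forms of an unknown optimal computation.  This file isolates the mathematical content of
that case analysis and proves it sound, in the language of bilinear computations
(`BilinComp`, Bläser 2003 Def. 1):

* `constrSub K`, `constrSubF K c F` — the constrained subspaces; `BilinComp.restrictAlong` — the
  substitution step along an inclusion `S' ≤ S` discarding products whose first form vanishes on
  `S'` (Wang 2026, Lemma 3, one step); `BilinComp.dropZero`, `BilinComp.reindex` — plumbing.
* `succ_le_card_of_forall_candidate` — the **one-level rule**: if `φ|_S ≠ 0` and every
  hyperplane section `φ|_{S ∩ ker c_n}` through a *covering* family of candidate forms `c_n`
  needs `≥ b` products, then `φ|_S` needs `≥ b + 1` (Wang 2026, §2 worked example: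
  "Since this holds for every nonzero form, `R ≥ 1 + 6`").
* `NodeOK` / `le_card_of_nodeOK_root` — the **multi-level rule with masks** (Wang 2026, §6
  "Substitution with backtracking", §7 "Backtracking: for each DFS leaf, its depth, the subset of
  substituted forms …"): a node of depth `d` is a non-decreasing sequence `s` of candidate
  indices, read as the case "the computation, its products sorted by candidate index, has first
  `d` products with first forms proportional to `c_{s 0}, …, c_{s (d-1)}`"; a node is closed by
  a set `F` of candidates with `#{p < d | s p ∈ F} + LB(F) ≥ target` (imposing the forms in
  `F` kills at least the named products whose candidate lies in `F`, and the rest computes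
  `φ|_{S_F}`), or else by all children `s (d-1) ≤ m` provided `d < maxDepth`.  **Soundness**
  (`le_card_of_nodeOK_root`): if the oracle `LB` is sound on every `S_F`, the candidates cover
  every nonzero form on `S` up to a unit, `φ|_S ≠ 0`, every computation of `φ|_S` has at least
  `maxDepth` products (Wang: "The DFS depth is capped at the known lower bound"), and every
  root child is `NodeOK`, then every computation of `φ|_S` has at least `target` products.
  The hypothesis `maxDepth ≤` (every length) is exactly what makes the case analysis at an
  internal node exhaustive (a `(d+1)`-st product exists); a replaying verifier has to check it
  against an independently certified bound.

Scope note. The node rule here credits `#{p < d | s p ∈ F}` killed products for an arbitrary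
set `F`; Wang's implementation records `F ⊆ {s 0, …, s (d-1)}` with `s (d-1) ∈ F` and credits
`|F|`, which is the special case (`#{p | s p ∈ F} ≥ |F|` then).  Wang orders candidates so that
children have index `≤` the last one; we use `≥` (the same rule after reversing the candidate
order).  Orbit canonicalisation (Lemma 1) is not part of this file: `LB` is an arbitrary sound
oracle.

## References

* C. Wang, *Automated Lower Bounds for Bilinear Complexity over Finite Fields*, arXiv:2603.07280
  (2026), §2, §3.2, §6 (Lemma 3, Substitution with backtracking), §7. [Wang2026]
* M. Bläser, J. Complexity 19 (2003) 43–60, Def. 1. [Blaser2003]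
-/

namespace Literature.Computability.AlgebraicComplexity

open Module

variable {k : Type*} [Field k]
variable {U V W : Type*} [AddCommGroup U] [Module k U] [AddCommGroup V] [Module k V]
  [AddCommGroup W] [Module k W]

/-! ## Constrained subspaces -/

/-- The subspace of the first argument cut out by the constraints `K` (Wang 2026, §3.2: "a set
of constraints cuts `A` down to the subspace on which all of them vanish").
[cite: Wang2026, §3.2] -/
def constrSub (K : List (Dual k U)) : Submodule k U := ⨅ κ ∈ K, LinearMap.ker κ

/-- Membership in `constrSub K`. [cite: Wang2026, §3.2] -/
theorem mem_constrSub {K : List (Dual k U)} {u : U} :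
    u ∈ constrSub K ↔ ∀ κ ∈ K, κ u = 0 := by
  simp [constrSub, Submodule.mem_iInf]

/-- The subspace after imposing, on top of `K`, the candidate forms `c n`, `n ∈ F`.
[cite: Wang2026, §6 (Substitution with backtracking)] -/
def constrSubF (K : List (Dual k U)) {N : ℕ} (c : Fin N → Dual k U) (F : Finset (Fin N)) :
    Submodule k U :=
  constrSub K ⊓ ⨅ n ∈ F, LinearMap.ker (c n)

/-- Membership in `constrSubF K c F`. [cite: Wang2026, §6 (Substitution with backtracking)] -/
theorem mem_constrSubF {K : List (Dual k U)} {N : ℕ} {c : Fin N → Dual k U} {F : Finset (Fin N)}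
    {u : U} : u ∈ constrSubF K c F ↔ u ∈ constrSub K ∧ ∀ n ∈ F, c n u = 0 := by
  simp [constrSubF, Submodule.mem_inf, Submodule.mem_iInf]

/-- `constrSubF K c F ≤ constrSub K`. [cite: Wang2026, §6 (Substitution with backtracking)] -/
theorem constrSubF_le (K : List (Dual k U)) {N : ℕ} (c : Fin N → Dual k U)
    (F : Finset (Fin N)) :
    constrSubF K c F ≤ constrSub K :=
  inf_le_left

namespace BilinComp

variable {ψ : U →ₗ[k] V →ₗ[k] W} {ι : Type*} [Fintype ι]

/-! ## Plumbing: reindexing, dropping zero products, restriction along an inclusion -/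

/-- Reindexing a computation along a bijection. [cite: Blaser2003, Def. 1] -/
def reindex {ι' : Type*} [Fintype ι'] (β : BilinComp ψ ι) (e : ι' ≃ ι) :
    BilinComp ψ ι' where
  f i := β.f (e i)
  g i := β.g (e i)
  w i := β.w (e i)
  map_eq_sum u v := by
    rw [β.map_eq_sum]
    exact (e.sum_comp (fun i => (β.f i u * β.g i v) • β.w i)).symm

/-- The forms of a reindexed computation. [cite: Blaser2003, Def. 1] -/
@[simp] theorem reindex_f {ι' : Type*} [Fintype ι'] (β : BilinComp ψ ι) (e : ι' ≃ ι)
    (i : ι') :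
    (β.reindex e).f i = β.f (e i) := rfl

variable [DecidableEq ι]

/-- Discarding products whose first form is zero. [cite: Wang2026, Lemma 3 (proof)] -/
def dropZero (β : BilinComp ψ ι) (J : Finset ι) (hJ : ∀ i ∈ J, β.f i = 0) :
    BilinComp ψ {i // i ∉ J} where
  f i := β.f i.1
  g i := β.g i.1
  w i := β.w i.1
  map_eq_sum u v := by
    rw [β.map_eq_sum]
    have h1 : ∑ i, (β.f i u * β.g i v) • β.w i
        = ∑ i ∈ Finset.univ.filter (fun i => i ∉ J), (β.f i u * β.g i v) • β.w i := by
      rw [Finset.sum_filter]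
      refine Finset.sum_congr rfl fun i _ => ?_
      by_cases hi : i ∉ J
      · simp [hi]
      · rw [not_not] at hi
        simp [hJ i hi]
    rw [h1]
    exact Finset.sum_subtype _ (by simp) (fun i => (β.f i u * β.g i v) • β.w i)

/-- Every computation can be shortened to one whose first forms are all nonzero.
[cite: Wang2026, Lemma 3 (proof)] -/
theorem exists_forall_f_ne_zero (β : BilinComp ψ ι) :
    ∃ r, r ≤ Fintype.card ι ∧ ∃ β' : BilinComp ψ (Fin r), ∀ i, β'.f i ≠ 0 := by
  classical
  let J : Finset ι := Finset.univ.filter (fun i => β.f i = 0)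
  have hJ : ∀ i ∈ J, β.f i = 0 := fun i hi => (Finset.mem_filter.1 hi).2
  let β' := β.dropZero J hJ
  have hc : Fintype.card {i // i ∉ J} = Fintype.card ι - J.card := by
    rw [Fintype.card_subtype_compl, Fintype.card_coe]
  refine ⟨Fintype.card ι - J.card, Nat.sub_le _ _,
    β'.reindex (Fintype.equivFinOfCardEq hc).symm, fun i => ?_⟩
  have hi := ((Fintype.equivFinOfCardEq hc).symm i).2
  simp only [reindex_f]
  intro h0
  exact hi (Finset.mem_filter.2 ⟨Finset.mem_univ _, h0⟩)

/-- **The substitution step along an inclusion** (Wang 2026, Lemma 3, one step; Lemma 1 for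
`J = ∅`): a computation of `φ|_{S × V}` and a smaller subspace `S' ≤ S` give a computation of
`φ|_{S' × V}` indexed by the products not in `J`, for any set `J` of products whose first form
vanishes on `S'`. [cite: Wang2026, Lemma 3] -/
def restrictAlong {φ : U →ₗ[k] V →ₗ[k] W} {S S' : Submodule k U}
    (β : BilinComp (φ.comp S.subtype) ι) (h : S' ≤ S) (J : Finset ι)
    (hJ : ∀ i ∈ J, ∀ u : S', β.f i (Submodule.inclusion h u) = 0) :
    BilinComp (φ.comp S'.subtype) {i // i ∉ J} where
  f i := (β.f i.1).comp (Submodule.inclusion h)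
  g i := β.g i.1
  w i := β.w i.1
  map_eq_sum u v := by
    have hu : φ.comp S'.subtype u = φ.comp S.subtype (Submodule.inclusion h u) := by
      simp [LinearMap.comp_apply, Submodule.coe_inclusion]
    rw [hu, β.map_eq_sum]
    have h1 : ∑ i, (β.f i (Submodule.inclusion h u) * β.g i v) • β.w i
        = ∑ i ∈ Finset.univ.filter (fun i => i ∉ J),
            (β.f i (Submodule.inclusion h u) * β.g i v) • β.w i := by
      rw [Finset.sum_filter]
      refine Finset.sum_congr rfl fun i _ => ?_
      by_cases hi : i ∉ J
      · simp [hi]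
      · rw [not_not] at hi
        simp [hJ i hi u]
    rw [h1]
    exact Finset.sum_subtype _ (by simp)
      (fun i => (β.f i (Submodule.inclusion h u) * β.g i v) • β.w i)

/-- Length bookkeeping for `restrictAlong`: a `Fin`-indexed version.
[cite: Wang2026, Lemma 3] -/
theorem exists_restrictAlong {φ : U →ₗ[k] V →ₗ[k] W} {S S' : Submodule k U}
    (β : BilinComp (φ.comp S.subtype) ι) (h : S' ≤ S) (J : Finset ι)
    (hJ : ∀ i ∈ J, ∀ u : S', β.f i (Submodule.inclusion h u) = 0) :
    Nonempty (BilinComp (φ.comp S'.subtype) (Fin (Fintype.card ι - J.card))) := by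
  have hc : Fintype.card {i // i ∉ J} = Fintype.card ι - J.card := by
    rw [Fintype.card_subtype_compl, Fintype.card_coe]
  exact ⟨(β.restrictAlong h J hJ).reindex (Fintype.equivFinOfCardEq hc).symm⟩

end BilinComp

/-! ## The one-level rule -/

section OneLevel

variable {φ : U →ₗ[k] V →ₗ[k] W}

/-- If `φ|_{S × V} ≠ 0`, every computation of it has a product whose first form is nonzero.
[cite: Wang2026, Lemma 3 (proof)] -/
theorem exists_f_ne_zero {S : Submodule k U} {ι : Type*} [Fintype ι]
    (β : BilinComp (φ.comp S.subtype) ι) (hφ : φ.comp S.subtype ≠ 0) :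
    ∃ i, β.f i ≠ 0 := by
  by_contra h
  have h' : ∀ i, β.f i = 0 := fun i => by_contra fun hi => h ⟨i, hi⟩
  apply hφ
  ext u v
  rw [β.map_eq_sum]
  simp [h']

/-- **One-level substitution** (Wang 2026, §2 example and §6): let `c_n` (`n < N`) be candidate
forms such that every nonzero form on `S` is a unit multiple of some `c_n` on `S` ("one per
canonical nonzero form"), and suppose `φ|_{S × V} ≠ 0`. If for every `n` every computation of
`φ|_{(S ∩ ker c_n) × V}` has at least `b` products, then every computation of `φ|_{S × V}` has
at least `b + 1`: its first product with nonzero first form `f_i = a c_n|_S` is killed by imposing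
`c_n`. [cite: Wang2026, §6 (Lemma 3 and Substitution with backtracking)] -/
theorem succ_le_card_of_forall_candidate {S : Submodule k U} {N : ℕ} (c : Fin N → Dual k U)
    (hcov : ∀ f : Dual k S, f ≠ 0 → ∃ n, ∃ a : k, a ≠ 0 ∧ ∀ u : S, f u = a * c n u)
    (hφ : φ.comp S.subtype ≠ 0) (b : ℕ)
    (hb : ∀ n r, BilinComp (φ.comp (S ⊓ LinearMap.ker (c n)).subtype) (Fin r) → b ≤ r)
    {ι : Type*} [Fintype ι] (β : BilinComp (φ.comp S.subtype) ι) :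
    b + 1 ≤ Fintype.card ι := by
  classical
  obtain ⟨i, hi⟩ := exists_f_ne_zero β hφ
  obtain ⟨n, a, _, hfa⟩ := hcov (β.f i) hi
  have hle : S ⊓ LinearMap.ker (c n) ≤ S := inf_le_left
  have hJ : ∀ j ∈ ({i} : Finset ι), ∀ u : ↥(S ⊓ LinearMap.ker (c n)),
      β.f j (Submodule.inclusion hle u) = 0 := by
    intro j hj u
    rw [Finset.mem_singleton.1 hj, hfa]
    have hu : c n (u : U) = 0 := (Submodule.mem_inf.1 u.2).2
    simp [Submodule.coe_inclusion, hu]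
  obtain ⟨β'⟩ := β.exists_restrictAlong hle {i} hJ
  have h1 := hb n _ β'
  have h2 : 1 ≤ Fintype.card ι := Fintype.card_pos_iff.2 ⟨i⟩
  simp only [Finset.card_singleton] at h1
  omega

end OneLevel

/-! ## The multi-level rule with masks (Wang's DFS) -/

section Backtracking

variable (φ : U →ₗ[k] V →ₗ[k] W) (K : List (Dual k U)) {N : ℕ} (c : Fin N → Dual k U)
  (LB : Finset (Fin N) → ℕ) (target maxDepth : ℕ)

/-- A DFS node — a sequence `s : Fin d → Fin N` of candidate indices — is **closed by the set
`F`** when `#{p | s p ∈ F} + LB F ≥ target` (Wang 2026, §7: "the depth, the subset of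
substituted forms, and … the orbit it reduced to"; the verifier "checks the substitution bound
popcount(mask) + rank meets the claimed lower bound").
[cite: Wang2026, §7 (Backtracking)] -/
def LeafOK (d : ℕ) (s : Fin d → Fin N) : Prop :=
  ∃ F : Finset (Fin N), target ≤ (Finset.univ.filter fun p => s p ∈ F).card + LB F

/-- **Wang's node rule** with fuel: a node is OK if it is closed by some `F`, or if
`d < maxDepth` and all children `m ≥ s (d-1)` are OK (Wang 2026, §6: "the technique certifies
the target only if every branch of the DFS — one per canonical nonzero form at each level —
reaches it"; "The DFS depth is capped at the known lower bound").
[cite: Wang2026, §6 (Substitution with backtracking)] -/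
def NodeOK : ℕ → (d : ℕ) → (Fin d → Fin N) → Prop
  | 0, d, s => LeafOK LB target d s
  | fuel + 1, d, s => LeafOK LB target d s ∨
      (d < maxDepth ∧
        ∀ m : Fin N, (∀ p : Fin d, s p ≤ m) → NodeOK fuel (d + 1) (Fin.snoc s m))

variable {φ K c LB target maxDepth}

/-- The induction behind soundness: follow the sorted sequence of the computation's own first
forms down the DFS. [cite: Wang2026, §6–§7 (soundness of backtracking)] -/
theorem le_of_nodeOK_prefix
    (hLB : ∀ F r, BilinComp (φ.comp (constrSubF K c F).subtype) (Fin r) → LB F ≤ r)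
    {r₀ : ℕ} (β : BilinComp (φ.comp (constrSub K).subtype) (Fin r₀))
    (t : Fin r₀ → Fin N) (ht : Monotone t) (a : Fin r₀ → k)
    (hf : ∀ i (u : constrSub K), β.f i u = a i * c (t i) u) (hdepth : maxDepth ≤ r₀) :
    ∀ fuel d (hd : d ≤ r₀), 0 < d →
      NodeOK LB target maxDepth fuel d (fun p => t (Fin.castLE hd p)) → target ≤ r₀ := by
  classical
  -- the leaf case, used twice
  have leaf : ∀ d (hd : d ≤ r₀), LeafOK LB target d (fun p => t (Fin.castLE hd p)) →
      target ≤ r₀ := by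
    intro d hd ⟨F, hF⟩
    -- the named products whose candidate lies in `F`
    let J : Finset (Fin r₀) :=
      ((Finset.univ : Finset (Fin d)).filter fun p => t (Fin.castLE hd p) ∈ F).map
        (Fin.castLEEmb hd)
    have hJcard : J.card = (Finset.univ.filter fun p : Fin d => t (Fin.castLE hd p) ∈ F).card :=
      Finset.card_map _
    have hJ : ∀ i ∈ J, ∀ u : ↥(constrSubF K c F),
        β.f i (Submodule.inclusion (constrSubF_le K c F) u) = 0 := by
      intro i hi u
      obtain ⟨p, hp, rfl⟩ := Finset.mem_map.1 hi
      have hpF : t (Fin.castLE hd p) ∈ F := (Finset.mem_filter.1 hp).2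
      rw [hf]
      have hu : c (t (Fin.castLE hd p)) (u : U) = 0 := (mem_constrSubF.1 u.2).2 _ hpF
      simp [Submodule.coe_inclusion, Fin.castLEEmb_apply, hu]
    obtain ⟨β'⟩ := β.exists_restrictAlong (constrSubF_le K c F) J hJ
    have h1 := hLB F _ β'
    have h2 : J.card ≤ r₀ := by
      simpa using Finset.card_le_univ J
    simp only [Fintype.card_fin] at h1
    dsimp only at hF
    rw [← hJcard] at hF
    omega
  intro fuel
  induction fuel with
  | zero => intro d hd _ h; exact leaf d hd h
  | succ fuel ih =>
    intro d hd hd0 h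
    rcases h with h | ⟨hdm, hch⟩
    · exact leaf d hd h
    · -- internal node: the `(d+1)`-st product exists since `d < maxDepth ≤ r₀`
      have hd1 : d + 1 ≤ r₀ := by omega
      have hm : ∀ p : Fin d, t (Fin.castLE hd p) ≤ t ⟨d, by omega⟩ :=
        fun p => ht (by simp [Fin.le_def])
      have hchild := hch (t ⟨d, by omega⟩) hm
      have e : (Fin.snoc (fun p : Fin d => t (Fin.castLE hd p)) (t ⟨d, by omega⟩) :
          Fin (d + 1) → Fin N) = fun p => t (Fin.castLE hd1 p) := by
        funext p
        refine Fin.lastCases ?_ (fun q => ?_) p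
        · simp only [Fin.snoc_last]
          congr 1
        · simp only [Fin.snoc_castSucc]
          congr 1
      rw [e] at hchild
      exact ih (d + 1) hd1 (Nat.succ_pos d) hchild

/-- **Soundness of substitution with backtracking** (Wang 2026, §6–§7). Hypotheses: the
oracle `LB F` is a valid lower bound for every computation of `φ|_{S_F × V}`,
`S_F = constrSub K ∩ ⋂_{n ∈ F} ker c_n`; the candidates `c_n` cover every nonzero form on
`S = constrSub K` up to a unit; `φ|_{S × V} ≠ 0`; every computation of `φ|_{S × V}` has at
least `maxDepth` products (the previously certified bound); and every root child `(m)` is `NodeOK`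
with some fuel. Conclusion: every computation of `φ|_{S × V}` has at least `target` products.
[cite: Wang2026, §6–§7 (Substitution with backtracking; soundness)] -/
theorem le_card_of_nodeOK_root
    (hLB : ∀ F r, BilinComp (φ.comp (constrSubF K c F).subtype) (Fin r) → LB F ≤ r)
    (hcov : ∀ f : Dual k (constrSub K), f ≠ 0 →
      ∃ n, ∃ a : k, a ≠ 0 ∧ ∀ u, f u = a * c n u)
    (hφ : φ.comp (constrSub K).subtype ≠ 0)
    (hdepth : ∀ r, BilinComp (φ.comp (constrSub K).subtype) (Fin r) → maxDepth ≤ r)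
    (fuel : ℕ) (hroot : ∀ m : Fin N, NodeOK LB target maxDepth fuel 1 (fun _ => m))
    {ι : Type*} [Fintype ι] (β : BilinComp (φ.comp (constrSub K).subtype) ι) :
    target ≤ Fintype.card ι := by
  classical
  -- shorten to nonzero first forms
  obtain ⟨r₀, hr₀, β₀, hnz⟩ := β.exists_forall_f_ne_zero
  refine le_trans ?_ hr₀
  -- candidates and units for each product, then sort by candidate index
  choose n a ha hfa using fun i => hcov (β₀.f i) (hnz i)
  let σ := Tuple.sort n
  have ht : Monotone (n ∘ σ) := Tuple.monotone_sort n
  let β₁ := β₀.reindex σ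
  have hf : ∀ i (u : constrSub K), β₁.f i u = (a ∘ σ) i * c ((n ∘ σ) i) u := fun i u =>
    hfa (σ i) u
  have hpos : 0 < r₀ := by
    obtain ⟨i, _⟩ := exists_f_ne_zero β₀ hφ
    exact Fin.pos i
  have h1 : (1 : ℕ) ≤ r₀ := hpos
  have e : (fun p : Fin 1 => (n ∘ σ) (Fin.castLE h1 p)) = fun _ => (n ∘ σ) ⟨0, hpos⟩ := by
    funext p
    have : p = 0 := Subsingleton.elim _ _
    subst this
    rfl
  have := hroot ((n ∘ σ) ⟨0, hpos⟩)
  rw [← e] at this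
  exact le_of_nodeOK_prefix hLB β₁ (n ∘ σ) ht (a ∘ σ) hf (hdepth r₀ β₀) fuel 1 h1
    Nat.one_pos this

end Backtracking

/-! ## Discharging the covering hypothesis -/

section Cover

variable {K : List (Dual k U)} {N : ℕ} {c : Fin N → Dual k U}

/-- If the candidates contain, up to a unit on `S = constrSub K`, every linear form on `U` that
does not vanish on `S` (Wang 2026, §6: the DFS runs over "the nonzero linear forms supported
away from the current pivots, one per coset"), then they cover every nonzero form on `S` in the
sense of `le_card_of_nodeOK_root`: extend the form from `S` to `U` (`Subspace.dualLift`).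
[cite: Wang2026, §6 (Substitution with backtracking)] -/
theorem cover_of_forall_dual
    (hc : ∀ g : Dual k U, (∃ u ∈ constrSub K, g u ≠ 0) →
      ∃ n, ∃ a : k, a ≠ 0 ∧ ∀ u ∈ constrSub K, g u = a * c n u) :
    ∀ f : Dual k (constrSub K), f ≠ 0 → ∃ n, ∃ a : k, a ≠ 0 ∧ ∀ u, f u = a * c n u := by
  intro f hf
  obtain ⟨u, hu⟩ : ∃ u : constrSub K, f u ≠ 0 := by
    by_contra h
    apply hf
    ext u
    by_contra h'
    exact h ⟨u, h'⟩
  have hg : ∃ u ∈ constrSub K, Subspace.dualLift (constrSub K) f u ≠ 0 :=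
    ⟨u, u.2, by rwa [Subspace.dualLift_of_subtype]⟩
  obtain ⟨n, a, ha, h⟩ := hc _ hg
  exact ⟨n, a, ha, fun u => by rw [← Subspace.dualLift_of_subtype (W := constrSub K) u, h u u.2]⟩

/-- In particular, if every linear form on `U` is proportional on `S` (by a unit) to some
candidate — e.g. the candidates list all of `U^*`, or one representative of each nonzero coset
of `span K` — the covering hypothesis holds. [cite: Wang2026, §6 (Substitution with backtracking)] -/
theorem cover_of_forall_dual' (hc : ∀ g : Dual k U, ∃ n, ∃ a : k, a ≠ 0 ∧
      ∀ u ∈ constrSub K, g u = a * c n u) :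
    ∀ f : Dual k (constrSub K), f ≠ 0 → ∃ n, ∃ a : k, a ≠ 0 ∧ ∀ u, f u = a * c n u :=
  cover_of_forall_dual fun g _ => hc g

end Cover

/-! ## The flattening bound in computation language -/

section Flatten

variable {ψ : U →ₗ[k] V →ₗ[k] W} {ι : Type*} [Fintype ι]

/-- **Flattening bound** (Wang 2026, §6 "Flatten": the flattening ranks of the constrained
tensor bound its rank from below), in computation language: the slices `ψ(u, ·)`, `u ∈ U`, of
a bilinear map with a computation indexed by `ι` span a space of dimension `≤ |ι|` — they lie in
the span of the `|ι|` rank-one maps `v ↦ g_i(v) w_i`. With `BilinComp.flip` (slices `ψ(·, v)`)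
and `BilinComp.rotate` (slices `ℓ ∘ ψ`, file `SingleProductExchange.lean`) this gives all three
flattening bounds. [cite: Wang2026, §6 (Flatten)] -/
theorem BilinComp.finrank_range_le_card (β : BilinComp ψ ι) :
    finrank k (LinearMap.range ψ) ≤ Fintype.card ι := by
  classical
  let b : ι → (V →ₗ[k] W) := fun i => (β.g i).smulRight (β.w i)
  have hle : LinearMap.range ψ ≤ Submodule.span k (Set.range b) := by
    rintro _ ⟨u, rfl⟩
    have hu : ψ u = ∑ i, β.f i u • b i := by
      ext v
      rw [β.map_eq_sum, LinearMap.sum_apply]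
      refine Finset.sum_congr rfl fun i _ => ?_
      simp [b, LinearMap.smulRight_apply, mul_smul]
    rw [hu]
    exact Submodule.sum_mem _ fun i _ => Submodule.smul_mem _ _ (Submodule.subset_span ⟨i, rfl⟩)
  haveI : FiniteDimensional k (Submodule.span k (Set.range b)) :=
    FiniteDimensional.span_of_finite k (Set.finite_range b)
  calc finrank k (LinearMap.range ψ) ≤ finrank k (Submodule.span k (Set.range b)) :=
        Submodule.finrank_mono hle
    _ ≤ Fintype.card ι := _root_.finrank_range_le_card b

/-- The flattening bound for constrained maps, in the `Fin r` form used by the oracle hypotheses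
of `le_card_of_nodeOK_root`: if the slices of `φ|_{S × V}` span a space of dimension `≥ b`, every
computation of `φ|_{S × V}` has at least `b` products. [cite: Wang2026, §6 (Flatten)] -/
theorem le_of_finrank_range_le {φ : U →ₗ[k] V →ₗ[k] W} {S : Submodule k U} {b : ℕ}
    (hb : b ≤ finrank k (LinearMap.range (φ.comp S.subtype))) (r : ℕ)
    (β : BilinComp (φ.comp S.subtype) (Fin r)) : b ≤ r := by
  simpa using hb.trans β.finrank_range_le_card

/-- The second flattening (slices `φ|_S(·, v)`, `v ∈ V`) in `Fin r` form, via `BilinComp.flip`.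
[cite: Wang2026, §6 (Flatten)] -/
theorem le_of_finrank_range_flip_le {φ : U →ₗ[k] V →ₗ[k] W} {S : Submodule k U} {b : ℕ}
    (hb : b ≤ finrank k (LinearMap.range (φ.comp S.subtype).flip)) (r : ℕ)
    (β : BilinComp (φ.comp S.subtype) (Fin r)) : b ≤ r := by
  simpa using hb.trans β.flip.finrank_range_le_card

/-- The third flattening (slices `ℓ ∘ φ|_S`, `ℓ ∈ W^*`) in `Fin r` form, via `BilinComp.rotate`.
[cite: Wang2026, §6 (Flatten)] -/
theorem le_of_finrank_range_rotate_le {φ : U →ₗ[k] V →ₗ[k] W} {S : Submodule k U} {b : ℕ}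
    (hb : b ≤ finrank k (LinearMap.range (rotateMap (φ.comp S.subtype)))) (r : ℕ)
    (β : BilinComp (φ.comp S.subtype) (Fin r)) : b ≤ r := by
  simpa using hb.trans β.rotate.finrank_range_le_card

end Flatten

/-! ## Executable replay of a DFS certificate (the verifier's "replay the case analysis") -/

section Replay

variable {N : ℕ}

/-- A backtracking certificate for one round: a leaf carries the closing set `F`; an internal node
carries one child per candidate index (the children for `m` below the last index are never
inspected). Wang's `.btp` trace lists the leaves in DFS pre-order; this is the same tree made
explicit. [cite: Wang2026, §7 (Backtracking)] -/
inductive BCert (N : ℕ) : Type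
  | leaf (F : Finset (Fin N)) : BCert N
  | node (cs : Fin N → BCert N) : BCert N

/-- A fuel bound for a certificate (its height). [cite: Wang2026, §7 (Backtracking)] -/
def BCert.height : BCert N → ℕ
  | .leaf _ => 0
  | .node cs => (Finset.univ.sup fun m => (cs m).height) + 1

variable (LB : Finset (Fin N) → ℕ) (target maxDepth : ℕ)

/-- **The replay check** (Wang 2026, §7: "The verifier replays the case analysis and confirms
that the recorded leaves cover every canonical nonzero form at each level"): a leaf is accepted
iff `target ≤ #{p | s p ∈ F} + LB F`; a node iff `d < maxDepth` and every child `m` above all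
entries of `s` is accepted at depth `d + 1`. [cite: Wang2026, §7 (Backtracking)] -/
def BCert.check : BCert N → (d : ℕ) → (Fin d → Fin N) → Bool
  | .leaf F, _, s => decide (target ≤ (Finset.univ.filter fun p => s p ∈ F).card + LB F)
  | .node cs, d, s => decide (d < maxDepth) &&
      decide (∀ m : Fin N, (∀ p : Fin d, s p ≤ m) → (cs m).check (d + 1) (Fin.snoc s m) = true)

variable {LB target maxDepth}

/-- `NodeOK` is monotone in the fuel. [cite: Wang2026, §6 (Substitution with backtracking)] -/
theorem NodeOK.mono {fuel fuel' : ℕ} (h : fuel ≤ fuel') {d : ℕ} {s : Fin d → Fin N}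
    (hn : NodeOK LB target maxDepth fuel d s) : NodeOK LB target maxDepth fuel' d s := by
  induction fuel' generalizing fuel d with
  | zero =>
    have : fuel = 0 := Nat.le_zero.1 h
    subst this
    exact hn
  | succ fuel' ih =>
    rcases Nat.eq_zero_or_pos fuel with rfl | hpos
    · exact Or.inl hn
    · obtain ⟨f, rfl⟩ : ∃ f, fuel = f + 1 := ⟨fuel - 1, by omega⟩
      rcases hn with hl | ⟨hd, hch⟩
      · exact Or.inl hl
      · exact Or.inr ⟨hd, fun m hm => ih (by omega) (hch m hm)⟩

/-- **Soundness of the replay**: an accepted certificate establishes `NodeOK` (with fuel its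
height). [cite: Wang2026, §7 (Backtracking)] -/
theorem BCert.nodeOK_of_check : ∀ (t : BCert N) (d : ℕ) (s : Fin d → Fin N),
    t.check LB target maxDepth d s = true → NodeOK LB target maxDepth t.height d s
  | .leaf F, d, s, h => by
    have hl : LeafOK LB target d s := ⟨F, by simpa [BCert.check] using h⟩
    simp only [BCert.height]
    exact hl
  | .node cs, d, s, h => by
    simp only [BCert.check, Bool.and_eq_true, decide_eq_true_eq] at h
    obtain ⟨hd, hch⟩ := h
    simp only [BCert.height]
    refine Or.inr ⟨hd, fun m hm => ?_⟩
    have ih := BCert.nodeOK_of_check (cs m) (d + 1) (Fin.snoc s m) (hch m hm)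
    exact ih.mono (Finset.le_sup (f := fun m => (cs m).height) (Finset.mem_univ m))

/-- **Replay form of the soundness theorem**: with a root family of accepted certificates in
place of the abstract `NodeOK` hypothesis of `le_card_of_nodeOK_root`.
[cite: Wang2026, §6–§7 (Substitution with backtracking; verification)] -/
theorem le_card_of_check_root {φ : U →ₗ[k] V →ₗ[k] W} {K : List (Dual k U)}
    {c : Fin N → Dual k U}
    (hLB : ∀ F r, BilinComp (φ.comp (constrSubF K c F).subtype) (Fin r) → LB F ≤ r)
    (hcov : ∀ f : Dual k (constrSub K), f ≠ 0 →
      ∃ n, ∃ a : k, a ≠ 0 ∧ ∀ u, f u = a * c n u)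
    (hφ : φ.comp (constrSub K).subtype ≠ 0)
    (hdepth : ∀ r, BilinComp (φ.comp (constrSub K).subtype) (Fin r) → maxDepth ≤ r)
    (root : Fin N → BCert N)
    (hroot : ∀ m : Fin N, (root m).check LB target maxDepth 1 (fun _ => m) = true)
    {ι : Type*} [Fintype ι] (β : BilinComp (φ.comp (constrSub K).subtype) ι) :
    target ≤ Fintype.card ι := by
  classical
  refine le_card_of_nodeOK_root hLB hcov hφ hdepth
    (Finset.univ.sup fun m => (root m).height) (fun m => ?_) β
  exact (BCert.nodeOK_of_check (root m) 1 _ (hroot m)).mono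
    (Finset.le_sup (f := fun m => (root m).height) (Finset.mem_univ m))

end Replay

end Literature.Computability.AlgebraicComplexity
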